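import Summits.QuantumFields.YangMills.Theorems.UnitScaleTiltProp7SectET3WCurrentRealityAtRecordT3
import Summits.QuantumFields.YangMills.Theorems.UnitScaleTiltProp7ChartCentralT3
import HarnessLib

/-!
# Route `UnitScaleTilt`, crux K1 child «MinimiserStabilityRegPr» (stmt-QuantumFields-19200), stub `stub_existenceMinimalOrbit` (EX), route (α) — THE (W-X′) INSTANTIATION OF THE
# DISPLAY'S `Wf`: **THE REALITY ROW `hWR` AT THE LETTERS OF RECORD WITH THE CHART BRICK (Z-C) DISCHARGED** — ✓`W80_isHermitian_trace_zero_at_record` ∘ ✓`Ctilde_add_central_of_regPr`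
# (`δ := (160·L)⁻¹`): the residue of `hWR` is now {the Sect. C regime `RC` of `(H̃, C̃)`, the V₀-group current's sector row (R-V₀)}

Cell `ym3-torus`, width seat `ym3-torus-px3` (gen 3; EX namer ★w2-19200 g7 WORD (9) 2026-08-28T23:58:13Z).  THEOREMS ONLY (0 `def`, 0 `sorry`); `--supports stmt-QuantumFields-19200 --as helper`;
count-neutral.  YM₃ on T³ is a ladder rung (R3), NOT the Clay problem; nothing here claims the stub, the crux, d = 4 or the mass gap.

THE PRINT.  [Balaban1985Variational] (51) p. 286 «for A′ with values in 𝔤 the configuration D(A′) has values in 𝔤 also», (80) p. 290, (84)–(89) pp. 290–291; [Balaban1985BackgroundPropagators]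
(3.14)–(3.15) p. 393, p. 393 «The operators … are real».

WHAT IS PROVED (sorry-free, no definition).  ★★★ **`W80_isHermitian_trace_zero_at_record_closed (ha) (hε₀ he hWe hWε) (U₀ hreg) (RC) (hV0) (A′) (hA′) (hA′S) (b)`** — the display's `hWR` text at the (W-X′) `Wf`
letter of record `W80 (rieszτ frobEquiv) tr (bgOfCfg F K U₀) (H1f … DeltaPiSlotP … U₀) C̃ εC (Jcur (bgOfCfg F K U₀)) (currentCLM frobEquiv (fun _ ↦ K−n) (nabla115 η (bgOfCfg F K U₀)) (DeltaEtaSlot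
F n K c₀ U₀))`, at `U₀ ∈ 𝔘_k(ε₀)` in the windows `10⁹L²e ≤ 1`, `10¹²L³ε₀ ≤ 1`, `0 ≤ a`, GIVEN ONLY `RC : Regime H̃ 0 C̃ bH 0 (40·(2·(3·(2e+2700Lε₀)))∕e²) (e∕2) 0 aC εC` (N06-class: its
`norm_G` is the display's `norm_H₁`; `quad` = ✓p664073`.quadAnalytic`; numerics) and `hV0` ((R-V₀), located storey) — ✓`…AtRecord.W80_isHermitian_trace_zero_at_record` with its `hZC` row supplied
by ✓`Prop7SymAvgTwSym.Ctilde_add_central_of_regPr` at `δ := (160·L)⁻¹`.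
HONEST SCOPE.  A by-name composition; no estimate; nothing of Props 3–4 asserted; the EX stub is not touched.

References: T. Bałaban, CMP **102** (1985) 277–309 [Balaban1985Variational] ((44)–(51) pp.285–286, (80) p.290, (84)–(89) pp.290–291, (115) p.294); CMP **99** (1985) 389–434
[Balaban1985BackgroundPropagators] ((3.14)–(3.15) p.393).
-/

set_option autoImplicit false

noncomputable section

open scoped InnerProductSpace ComplexConjugate Matrix.Norms.L2Operator BigOperators

namespace Summit.QuantumFields.YangMills.Theorems.Prop7SectET3WCurrentRealityClosed

open Literature.MathematicalPhysics.QuantumFieldTheory.Balaban1983to89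
open Literature.MathematicalPhysics.QuantumFieldTheory.Balaban1983to89.T3ContinuumYM3Torus
open T3SectALandauChart (eta eta_pos)
open T3PrintedRegularMinimiser (RegPr)
open B9SectCLatticeCarrier (Bond)
open B11Eq115Space (NegSup NegSize Space115 JetSup levWeight)
open B11Eq111FrakG (nabla115)
open B11Eq174Chart (Regime)
open B11Prop6Scheme (Prop4Hyp)
open B11Eq80Current (W80)
open B11Eq90V0GroupComposed (curV0full)
open B11Eq98CurrentSlot (Jcur)
open B11Eq98V0primeCurrentSlots (rieszτ)
open B9Eq3119DeltaPiCarrier (currentCLM)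
open Summit.QuantumFields.YangMills.Theorems.Prop7SectET3Transport (periodsT3 siteEquiv bondEquiv bgOfCfg)
open Summit.QuantumFields.YangMills.Theorems.Prop7SectET3HilbertLetters (W₂ frobEquiv toL2)
open Summit.QuantumFields.YangMills.Theorems.Prop7SectET3CurvedPropagators (H1f)
open Summit.QuantumFields.YangMills.Theorems.Prop7SectET3WilsonHessian (DeltaEtaSlot)
open Summit.QuantumFields.YangMills.Theorems.Prop7SectET3DeltaPiPInv (DeltaPiSlotP)
open Summit.QuantumFields.YangMills.Theorems.Prop7SymAvgTwSym (CmapTwS Ctilde_add_central_of_regPr)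
open Summit.QuantumFields.YangMills.Theorems.Prop7SectET3WCurrentRealityAtRecord (W80_isHermitian_trace_zero_at_record)

section Record

variable (F : T3Family) (n K : ℕ) (h : n ≤ K) (c₀ cB a : ℝ) [Fact (0 < c₀)] [Fact (0 < cB)] [Fact (0 < (F.L : ℝ))] [Fact (0 < ((F.L : ℝ)⁻¹) ^ (K - n))]

/-- ★★★ **`hWR` AT THE (W-X′) LETTERS OF RECORD, RESIDUE {`RC`, (R-V₀)}** — ✓`W80_isHermitian_trace_zero_at_record` with the central-invariance row `hZC` supplied by ✓`Ctilde_add_central_of_regPr`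
(`δ := (160·L)⁻¹`). [cite: Balaban1985Variational, (51) p.286, (84)–(89) pp.290–291; Balaban1985BackgroundPropagators, (3.14)–(3.15) p.393] -/
theorem W80_isHermitian_trace_zero_at_record_closed (ha : 0 ≤ a)
    {ε₀ e : ℝ} (hε₀ : 0 < ε₀) (he : 0 < e) (hWe : 10 ^ 9 * (F.L : ℝ) ^ 2 * e ≤ 1) (hWε : 10 ^ 12 * (F.L : ℝ) ^ 3 * ε₀ ≤ 1)
    (U₀ : GaugeField (F.P K) 0 (Matrix.specialUnitaryGroup (Fin 2) ℂ)) (hreg : RegPr F n K ε₀ U₀)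
    {bH aC εC : ℝ}
    (RC : Regime (H1f F n K h c₀ cB a (DeltaPiSlotP F n K h c₀ cB a) U₀) 0
      (fun A' : Space115 (F.L : ℝ) (((F.L : ℝ)⁻¹) ^ (K - n)) (fun _ : Bond 3 (periodsT3 F K) => K - n)
        (fun _ : Bond 3 (periodsT3 F K) × Fin 3 => K - n) (nabla115 (((F.L : ℝ)⁻¹) ^ (K - n)) (bgOfCfg F K U₀)) =>
          (-Complex.I) • CmapTwS F n K h U₀ (((((eta F n K : ℝ) : ℂ)) * Complex.I) • fun b : PBond (F.P K) 0 => JetSup.equiv _ _ _ A' (bondEquiv F K b)))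
      bH 0 (40 * (2 * (3 * (2 * e + 2700 * (F.L : ℝ) * ε₀))) / e ^ 2) (e / 2) 0 aC εC)
    (hV0 : ∀ A' : Space115 (F.L : ℝ) (((F.L : ℝ)⁻¹) ^ (K - n)) (fun _ : Bond 3 (periodsT3 F K) => K - n)
        (fun _ : Bond 3 (periodsT3 F K) × Fin 3 => K - n) (nabla115 (((F.L : ℝ)⁻¹) ^ (K - n)) (bgOfCfg F K U₀)), ‖A'‖ < aC →
      (∀ b, (JetSup.equiv _ _ _ A' b).IsHermitian ∧ (JetSup.equiv _ _ _ A' b).trace = 0) →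
      ∀ b, (NegSup.equiv _ _ (curV0full (rieszτ frobEquiv) (LinearMap.toContinuousLinearMap (Matrix.traceLinearMap (Fin 2) ℂ ℂ)) (bgOfCfg F K U₀)
          (H1f F n K h c₀ cB a (DeltaPiSlotP F n K h c₀ cB a) U₀)
          (fun A' : Space115 (F.L : ℝ) (((F.L : ℝ)⁻¹) ^ (K - n)) (fun _ : Bond 3 (periodsT3 F K) => K - n)
            (fun _ : Bond 3 (periodsT3 F K) × Fin 3 => K - n) (nabla115 (((F.L : ℝ)⁻¹) ^ (K - n)) (bgOfCfg F K U₀)) =>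
              (-Complex.I) • CmapTwS F n K h U₀ (((((eta F n K : ℝ) : ℂ)) * Complex.I) • fun b : PBond (F.P K) 0 => JetSup.equiv _ _ _ A' (bondEquiv F K b)))
          εC A') b).IsHermitian ∧
        (NegSup.equiv _ _ (curV0full (rieszτ frobEquiv) (LinearMap.toContinuousLinearMap (Matrix.traceLinearMap (Fin 2) ℂ ℂ)) (bgOfCfg F K U₀)
          (H1f F n K h c₀ cB a (DeltaPiSlotP F n K h c₀ cB a) U₀)
          (fun A' : Space115 (F.L : ℝ) (((F.L : ℝ)⁻¹) ^ (K - n)) (fun _ : Bond 3 (periodsT3 F K) => K - n)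
            (fun _ : Bond 3 (periodsT3 F K) × Fin 3 => K - n) (nabla115 (((F.L : ℝ)⁻¹) ^ (K - n)) (bgOfCfg F K U₀)) =>
              (-Complex.I) • CmapTwS F n K h U₀ (((((eta F n K : ℝ) : ℂ)) * Complex.I) • fun b : PBond (F.P K) 0 => JetSup.equiv _ _ _ A' (bondEquiv F K b)))
          εC A') b).trace = 0)
    (A' : Space115 (F.L : ℝ) (((F.L : ℝ)⁻¹) ^ (K - n)) (fun _ : Bond 3 (periodsT3 F K) => K - n)
      (fun _ : Bond 3 (periodsT3 F K) × Fin 3 => K - n) (nabla115 (((F.L : ℝ)⁻¹) ^ (K - n)) (bgOfCfg F K U₀)))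
    (hA' : ‖A'‖ < aC) (hA'S : ∀ b, (JetSup.equiv _ _ _ A' b).IsHermitian ∧ (JetSup.equiv _ _ _ A' b).trace = 0) (b : Bond 3 (periodsT3 F K)) :
    (NegSup.equiv _ _ (W80 (rieszτ frobEquiv) (LinearMap.toContinuousLinearMap (Matrix.traceLinearMap (Fin 2) ℂ ℂ)) (bgOfCfg F K U₀)
        (H1f F n K h c₀ cB a (DeltaPiSlotP F n K h c₀ cB a) U₀)
        (fun A' : Space115 (F.L : ℝ) (((F.L : ℝ)⁻¹) ^ (K - n)) (fun _ : Bond 3 (periodsT3 F K) => K - n)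
          (fun _ : Bond 3 (periodsT3 F K) × Fin 3 => K - n) (nabla115 (((F.L : ℝ)⁻¹) ^ (K - n)) (bgOfCfg F K U₀)) =>
            (-Complex.I) • CmapTwS F n K h U₀ (((((eta F n K : ℝ) : ℂ)) * Complex.I) • fun b : PBond (F.P K) 0 => JetSup.equiv _ _ _ A' (bondEquiv F K b)))
        εC (Jcur (bgOfCfg F K U₀))
        (currentCLM frobEquiv (fun _ : Bond 3 (periodsT3 F K) × Fin 3 => K - n) (nabla115 (((F.L : ℝ)⁻¹) ^ (K - n)) (bgOfCfg F K U₀)) (DeltaEtaSlot F n K c₀ U₀))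
        A') b).IsHermitian ∧
    (NegSup.equiv _ _ (W80 (rieszτ frobEquiv) (LinearMap.toContinuousLinearMap (Matrix.traceLinearMap (Fin 2) ℂ ℂ)) (bgOfCfg F K U₀)
        (H1f F n K h c₀ cB a (DeltaPiSlotP F n K h c₀ cB a) U₀)
        (fun A' : Space115 (F.L : ℝ) (((F.L : ℝ)⁻¹) ^ (K - n)) (fun _ : Bond 3 (periodsT3 F K) => K - n)
          (fun _ : Bond 3 (periodsT3 F K) × Fin 3 => K - n) (nabla115 (((F.L : ℝ)⁻¹) ^ (K - n)) (bgOfCfg F K U₀)) =>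
            (-Complex.I) • CmapTwS F n K h U₀ (((((eta F n K : ℝ) : ℂ)) * Complex.I) • fun b : PBond (F.P K) 0 => JetSup.equiv _ _ _ A' (bondEquiv F K b)))
        εC (Jcur (bgOfCfg F K U₀))
        (currentCLM frobEquiv (fun _ : Bond 3 (periodsT3 F K) × Fin 3 => K - n) (nabla115 (((F.L : ℝ)⁻¹) ^ (K - n)) (bgOfCfg F K U₀)) (DeltaEtaSlot F n K c₀ U₀))
        A') b).trace = 0 := by
  have hL : (0 : ℝ) < F.L := Fact.out
  have hδ : (0 : ℝ) < (160 * (F.L : ℝ))⁻¹ := inv_pos.2 (by positivity)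
  exact W80_isHermitian_trace_zero_at_record F n K h c₀ cB a ha hε₀ he hWe hWε U₀ hreg RC hδ
    (Ctilde_add_central_of_regPr F h hε₀ he hWe hWε U₀ hreg) hV0 A' hA' hA'S b

end Record

end Summit.QuantumFields.YangMills.Theorems.Prop7SectET3WCurrentRealityClosed

end
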